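import Literature.AlgebraicGeometry.Resolution.ResiduallyAlgebraicReduction
import Literature.AlgebraicGeometry.Resolution.DiscreteSeparableResidueLocalUniformization
import Summits.ResolutionOfSingularities.ResolutionOfSingularities.Theorems.SoloInformedDiscrete
import HarnessLib

/-!
# The summit split at discrete valuations whose residues are separable over constants in `O`

Summit-side packaging (solo/informed residency, session 4). Session 3 split the summit's
`p`-component at `Disc(k, O)` := "`O` is a discrete valuation ring and every residue of `O` is
separable-algebraic over `k`" (`SoloInformedDiscrete`). The hypothesis "over `k`" is not the
right one: relative local uniformization descends along any finitely generated extension of the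
ground field inside `O` (`RelLocalUniformization.of_ground_intermediateField`), so the same
claimed Theorem D (`HD`, carried as an explicit hypothesis exactly as in `SoloInformedDiscrete`)
covers the larger class

* `SepConst(k, O)` := `O` is a discrete valuation ring and there is a finitely generated
  intermediate field `k ⊆ k₁ ⊆ O` such that every residue of `O` is a root of a separable
  polynomial over `k₁` (the residue field is separable-algebraic over the image of `k₁`).

Equivalently (for `O` of rank one in a finitely generated `K/k`): the residue field `κ(O)` is
separably generated over the image of some finitely generated subfield of constants lying in
`O`; over a PERFECT ground field `k` this says exactly that `κ(O)/k` admits a separating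
transcendence basis (lift one into `O`), so the discrete rank-one valuation rings left in the
residual core over a perfect field are those whose residue field is NOT separably generated
over `k` — e.g. `κ(O) ⊇ k(u, u^{1/p}, u^{1/p²}, …)`, which exist on `k(x₁, …, x₅)` by
Kuhlmann's construction of valuations with prescribed countably generated residue field
[Kuhlmann 2004, "Value groups, residue fields and bad places of rational function fields",
Thm. 1.1].

Results (granted Temkin 2013 in height one, Cossart–Piltant 2019 in dimension `≤ 3`, and `HD`):

* `sepConst_of_disc` — `Disc(k, O) ⇒ SepConst(k, O)` (take `k₁ = k`), so the residual core
  below is contained in the session-3 one;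
* `relLocalUniformization_of_disc_over_constants` — relative local uniformization over `k` at
  every rank-one `O` with `SepConst(k, O)`, in every dimension;
* `relLocalUniformization_of_sepConst_and_residual` — `HD` + the core steps at the rank-one
  valuation rings with `¬ SepConst(k, O)` ⇒ relative local uniformization of every valuation
  ring over `k` (any rank);
* `resolutionInChar_iff_twoModelPatching_and_sepConstResidual`,
  `resolutionOfSingularities_iff_twoModelPatching_and_sepConstResidual` — resolution in
  characteristic `p` (resp. the summit statement) is EQUIVALENT to two-model patching of proper
  models ∧ the core model-form `μ_p`-torsor steps at the rank-one valuation rings with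
  `¬ SepConst(k, O)`;
* `relLocalUniformization_of_sepConst_and_raResidual`,
  `resolutionInChar_iff_twoModelPatching_and_sepConstRaResidual`,
  `resolutionOfSingularities_iff_twoModelPatching_and_sepConstRaResidual` — the same with the
  residual class cut down further to the RESIDUALLY ALGEBRAIC rank-one valuation rings with
  `¬ SepConst(k, O)` (a sub-class of the residual class of `SoloInformedFinalCore`).
The `⇒` directions do not use `HD`.
-/

noncomputable section

namespace Summit.ResolutionOfSingularities.ResolutionOfSingularities.Theorems

open CategoryTheory AlgebraicGeometry
open Literature.AlgebraicGeometry Literature.AlgebraicGeometry.Resolution Polynomial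

/-- `Disc(k, O) ⇒ SepConst(k, O)`: a discrete valuation ring containing `k` all of whose
residues are separable-algebraic over `k` has them separable-algebraic over the finitely
generated intermediate field `k₁ = k` (`⊥`). [folklore] -/
theorem sepConst_of_disc {k K : Type} [Field k] [Field K] [Algebra k K] (O : ValuationSubring K)
    (hk : ∀ c : k, algebraMap k K c ∈ O) (hO : IsDiscreteValuationRing O)
    (hsep : ∀ t : K, t ∈ O → HasSeparableResidue k O t) :
    IsDiscreteValuationRing O ∧ ∃ k₁ : IntermediateField k K, k₁.FG ∧
      (∀ x : k₁, (x : K) ∈ O) ∧ ∀ t : K, t ∈ O → HasSeparableResidue k₁ O t := by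
  refine ⟨hO, ⊥, IntermediateField.fg_bot, fun x => ?_, fun t ht => ?_⟩
  · obtain ⟨c, hc⟩ := IntermediateField.mem_bot.mp x.2
    rw [← hc]
    exact hk c
  · obtain ⟨μ, hμ, hv⟩ := hsep t ht
    refine ⟨μ.map (algebraMap k (⊥ : IntermediateField k K)), hμ.map, ?_⟩
    rwa [Polynomial.aeval_map_algebraMap]

/-- **Relative local uniformization at `SepConst` valuation rings (granted Theorem D as `HD`).**
If `O` is a rank-one discrete valuation ring of a finitely generated `K/k` and the residues of
`O` are separable-algebraic over some finitely generated intermediate field `k ⊆ k₁ ⊆ O`, then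
`O` admits relative local uniformization over `k`: apply `HD` over the ground field `k₁`
(still of characteristic `p`, `K/k₁` still finitely generated), Temkin (height one) and
Cossart–Piltant (dim `≤ 3`) to get relative local uniformization over `k₁`, and descend to `k`
along the finitely generated extension `k₁/k` inside `O`. [folklore] -/
theorem relLocalUniformization_of_disc_over_constants {p : ℕ} [Fact p.Prime]
    (hT₁ : Temkin2013HeightLeOne.{0}) (hCP : CossartPiltant2019LU3.{0})
    (HD : ∀ (k K : Type) [Field k] [CharP k p] [Field K] [Algebra k K],
      (⊤ : IntermediateField k K).FG → ∀ O : ValuationSubring K, Nonempty O.valuation.RankOne →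
        (∀ c : k, algebraMap k K c ∈ O) → IsDiscreteValuationRing O →
        (∀ t : K, t ∈ O → HasSeparableResidue k O t) → RelMuPTorsorCoreStepsAt p k O)
    (k K : Type) [Field k] [CharP k p] [Field K] [Algebra k K]
    (hfg : (⊤ : IntermediateField k K).FG) (O : ValuationSubring K)
    (hr : Nonempty O.valuation.RankOne) (hO : IsDiscreteValuationRing O)
    (k₁ : IntermediateField k K) (hk₁fg : k₁.FG) (hk₁O : ∀ x : k₁, (x : K) ∈ O)
    (hsep : ∀ t : K, t ∈ O → HasSeparableResidue k₁ O t) :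
    RelLocalUniformization k K O := by
  haveI : CharP k₁ p := charP_of_injective_algebraMap (algebraMap k k₁).injective p
  have hfg₁ : (⊤ : IntermediateField k₁ K).FG := intermediateField_fg_top_of_fg_top k₁ hfg
  have hk₁ : ∀ c : k₁, algebraMap k₁ K c ∈ O := hk₁O
  exact RelLocalUniformization.of_ground_intermediateField k₁ hk₁fg O hk₁O
    (relLocalUniformization_of_relCoreStepsAt_of_rankOne hT₁ hCP O hr hk₁
      (HD k₁ K hfg₁ O hr hk₁ hO hsep))

/-- Granted `HD`: the core model-form `μ_p`-torsor steps at the rank-one valuation rings with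
`¬ SepConst(k, O)` give relative local uniformization of EVERY valuation ring over `k` (any
rank: Novacoski–Spivakovsky's reduction to rank one, proved in the tree, then the case split
`SepConst` / `¬ SepConst` at each rank-one valuation ring of a finitely generated subextension).
[cite: NovacoskiSpivakovsky2014, Thm. 1.1; Temkin2013, Section 4.1; CossartPiltant2019, Thm. 1.1] -/
theorem relLocalUniformization_of_sepConst_and_residual {p : ℕ} [Fact p.Prime]
    (hT₁ : Temkin2013HeightLeOne.{0}) (hCP : CossartPiltant2019LU3.{0})
    (HD : ∀ (k K : Type) [Field k] [CharP k p] [Field K] [Algebra k K],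
      (⊤ : IntermediateField k K).FG → ∀ O : ValuationSubring K, Nonempty O.valuation.RankOne →
        (∀ c : k, algebraMap k K c ∈ O) → IsDiscreteValuationRing O →
        (∀ t : K, t ∈ O → HasSeparableResidue k O t) → RelMuPTorsorCoreStepsAt p k O)
    (H : ∀ (k K : Type) [Field k] [CharP k p] [Field K] [Algebra k K],
      (⊤ : IntermediateField k K).FG → ∀ O : ValuationSubring K, Nonempty O.valuation.RankOne →
        (∀ c : k, algebraMap k K c ∈ O) →
        ¬ (IsDiscreteValuationRing O ∧ ∃ k₁ : IntermediateField k K, k₁.FG ∧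
            (∀ x : k₁, (x : K) ∈ O) ∧ ∀ t : K, t ∈ O → HasSeparableResidue k₁ O t) →
        RelMuPTorsorCoreStepsAt p k O)
    (k K : Type) [Field k] [CharP k p] [Field K] [Algebra k K] (O : ValuationSubring K) :
    RelLocalUniformization k K O := by
  refine NovacoskiSpivakovsky2014_holds k (fun K _ _ O hr => ?_) K O
  intro R hRfg hRfr hRO
  have hk : ∀ c : k, algebraMap k K c ∈ O := algebraMap_mem_of_le O R hRO
  have hfg : (⊤ : IntermediateField k K).FG := fg_top_of_model R hRfg hRfr
  by_cases hS : IsDiscreteValuationRing O ∧ ∃ k₁ : IntermediateField k K, k₁.FG ∧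
      (∀ x : k₁, (x : K) ∈ O) ∧ ∀ t : K, t ∈ O → HasSeparableResidue k₁ O t
  · obtain ⟨hO, k₁, hk₁fg, hk₁O, hsep⟩ := hS
    exact relLocalUniformization_of_disc_over_constants hT₁ hCP HD k K hfg O hr hO k₁ hk₁fg
      hk₁O hsep R hRfg hRfr hRO
  · exact relLocalUniformization_of_relCoreStepsAt_of_rankOne hT₁ hCP O hr hk
      (H k K hfg O hr hk hS) R hRfg hRfr hRO

/-- **The split of the summit's `p`-component at `SepConst`.** Granted Temkin (height one),
Cossart–Piltant (dim ≤ 3) and Theorem D (`HD`): resolution in characteristic `p` is EQUIVALENT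
to two-model patching of proper models ∧ the core model-form `μ_p`-torsor steps at the rank-one
valuation rings (of finitely generated extensions of fields of characteristic `p`) which are
NOT discrete with residues separable-algebraic over some finitely generated field of constants
inside `O`. `⇒` does not use `HD`. -/
theorem resolutionInChar_iff_twoModelPatching_and_sepConstResidual {p : ℕ} [Fact p.Prime]
    (hT₁ : Temkin2013HeightLeOne.{0}) (hCP : CossartPiltant2019LU3.{0})
    (HD : ∀ (k K : Type) [Field k] [CharP k p] [Field K] [Algebra k K],
      (⊤ : IntermediateField k K).FG → ∀ O : ValuationSubring K, Nonempty O.valuation.RankOne →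
        (∀ c : k, algebraMap k K c ∈ O) → IsDiscreteValuationRing O →
        (∀ t : K, t ∈ O → HasSeparableResidue k O t) → RelMuPTorsorCoreStepsAt p k O) :
    ResolutionInChar.{0} p ↔ ProperModel.TwoModelPatching.{0} p ∧
      (∀ (k K : Type) [Field k] [CharP k p] [Field K] [Algebra k K],
        (⊤ : IntermediateField k K).FG → ∀ O : ValuationSubring K,
          Nonempty O.valuation.RankOne → (∀ c : k, algebraMap k K c ∈ O) →
          ¬ (IsDiscreteValuationRing O ∧ ∃ k₁ : IntermediateField k K, k₁.FG ∧
              (∀ x : k₁, (x : K) ∈ O) ∧ ∀ t : K, t ∈ O → HasSeparableResidue k₁ O t) →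
            RelMuPTorsorCoreStepsAt p k O) :=
  ⟨fun h => ⟨ProperModel.twoModelPatching_of_resolutionInChar h,
      fun k K _ _ _ _ _ O _ hk _ => relCoreSteps_of_resolutionInChar h k K O hk⟩,
    fun h => resolutionInChar_of_properTwoModelPatching_of_lu h.1
      (fun k K _ _ _ _ hfg O hk => isLocallyUniformizable_of_relLocalUniformization hfg O hk
        (relLocalUniformization_of_sepConst_and_residual hT₁ hCP HD h.2 k K O))⟩

/-- **The summit itself, split at `SepConst`.** Granted Temkin (height one), Cossart–Piltant
(dim ≤ 3) and Theorem D for every prime (`HD`): resolution of singularities in positive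
characteristic (verbatim `Literature.AlgebraicGeometry.Resolution.ResolutionOfSingularities`) is
EQUIVALENT to: for every prime `p`, two-model patching of proper models in characteristic `p`
AND the core model-form `μ_p`-torsor steps at those rank-one valuation rings of finitely
generated extensions of fields of characteristic `p` which are not discrete with residues
separable-algebraic over a finitely generated field of constants inside the valuation ring. -/
theorem resolutionOfSingularities_iff_twoModelPatching_and_sepConstResidual
    (hT₁ : Temkin2013HeightLeOne.{0}) (hCP : CossartPiltant2019LU3.{0})
    (HD : ∀ p : ℕ, p.Prime → ∀ (k K : Type) [Field k] [CharP k p] [Field K] [Algebra k K],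
      (⊤ : IntermediateField k K).FG → ∀ O : ValuationSubring K, Nonempty O.valuation.RankOne →
        (∀ c : k, algebraMap k K c ∈ O) → IsDiscreteValuationRing O →
        (∀ t : K, t ∈ O → HasSeparableResidue k O t) → RelMuPTorsorCoreStepsAt p k O) :
    Literature.AlgebraicGeometry.Resolution.ResolutionOfSingularities ↔
      ∀ p : ℕ, p.Prime → ProperModel.TwoModelPatching.{0} p ∧
      (∀ (k K : Type) [Field k] [CharP k p] [Field K] [Algebra k K],
        (⊤ : IntermediateField k K).FG → ∀ O : ValuationSubring K,
          Nonempty O.valuation.RankOne → (∀ c : k, algebraMap k K c ∈ O) →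
          ¬ (IsDiscreteValuationRing O ∧ ∃ k₁ : IntermediateField k K, k₁.FG ∧
              (∀ x : k₁, (x : K) ∈ O) ∧ ∀ t : K, t ∈ O → HasSeparableResidue k₁ O t) →
            RelMuPTorsorCoreStepsAt p k O) := by
  refine forall_congr' fun p => forall_congr' fun hp => ?_
  haveI : Fact p.Prime := ⟨hp⟩
  exact resolutionInChar_iff_twoModelPatching_and_sepConstResidual hT₁ hCP (HD p hp)

/-- Granted `HD`: the core model-form `μ_p`-torsor steps at the rank-one valuation rings which
are RESIDUALLY ALGEBRAIC over the ground field and satisfy `¬ SepConst(k, O)` give relative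
local uniformization of every valuation ring over `k`. This residual hypothesis is literally
weaker than the one of `SoloInformedFinalCore` (`¬ Disc` there, `¬ SepConst` here, by
`sepConst_of_disc`): reduce to rank one (Novacoski–Spivakovsky), enlarge `k` inside `O` to a
finitely generated `k₁` over which `O` is residually algebraic
(`exists_intermediateField_isResiduallyAlgebraic`), split at `SepConst(k₁, O)`, and descend.
[cite: NovacoskiSpivakovsky2014, Thm. 1.1; Temkin2013, Section 4.1; CossartPiltant2019, Thm. 1.1] -/
theorem relLocalUniformization_of_sepConst_and_raResidual {p : ℕ} [Fact p.Prime]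
    (hT₁ : Temkin2013HeightLeOne.{0}) (hCP : CossartPiltant2019LU3.{0})
    (HD : ∀ (k K : Type) [Field k] [CharP k p] [Field K] [Algebra k K],
      (⊤ : IntermediateField k K).FG → ∀ O : ValuationSubring K, Nonempty O.valuation.RankOne →
        (∀ c : k, algebraMap k K c ∈ O) → IsDiscreteValuationRing O →
        (∀ t : K, t ∈ O → HasSeparableResidue k O t) → RelMuPTorsorCoreStepsAt p k O)
    (H : ∀ (k K : Type) [Field k] [CharP k p] [Field K] [Algebra k K],
      (⊤ : IntermediateField k K).FG → ∀ O : ValuationSubring K, Nonempty O.valuation.RankOne →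
        (∀ c : k, algebraMap k K c ∈ O) → IsResiduallyAlgebraic k O →
        ¬ (IsDiscreteValuationRing O ∧ ∃ k₁ : IntermediateField k K, k₁.FG ∧
            (∀ x : k₁, (x : K) ∈ O) ∧ ∀ t : K, t ∈ O → HasSeparableResidue k₁ O t) →
        RelMuPTorsorCoreStepsAt p k O)
    (k K : Type) [Field k] [CharP k p] [Field K] [Algebra k K] (O : ValuationSubring K) :
    RelLocalUniformization k K O := by
  classical
  refine NovacoskiSpivakovsky2014_holds k (fun K _ _ O hr => ?_) K O
  intro R hRfg hRfr hRO
  have hk : ∀ c : k, algebraMap k K c ∈ O := algebraMap_mem_of_le O R hRO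
  have hfg : (⊤ : IntermediateField k K).FG := fg_top_of_model R hRfg hRfr
  refine relLocalUniformization_of_forall_isResiduallyAlgebraic hfg O hk (fun k₁ hk₁O hra => ?_)
    R hRfg hRfr hRO
  haveI : CharP k₁ p := charP_of_injective_algebraMap (algebraMap k k₁).injective p
  have hfg₁ : (⊤ : IntermediateField k₁ K).FG := intermediateField_fg_top_of_fg_top k₁ hfg
  have hk₁ : ∀ c : k₁, algebraMap k₁ K c ∈ O := hk₁O
  by_cases hS : IsDiscreteValuationRing O ∧ ∃ k₂ : IntermediateField k₁ K, k₂.FG ∧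
      (∀ x : k₂, (x : K) ∈ O) ∧ ∀ t : K, t ∈ O → HasSeparableResidue k₂ O t
  · obtain ⟨hO, k₂, hk₂fg, hk₂O, hsep⟩ := hS
    exact relLocalUniformization_of_disc_over_constants hT₁ hCP HD k₁ K hfg₁ O hr hO k₂ hk₂fg
      hk₂O hsep
  · exact relLocalUniformization_of_relCoreStepsAt_of_rankOne hT₁ hCP O hr hk₁
      (H k₁ K hfg₁ O hr hk₁ hra hS)

/-- **The split of the summit's `p`-component at the residually algebraic `¬ SepConst` core.**
Granted Temkin (height one), Cossart–Piltant (dim ≤ 3) and Theorem D (`HD`): resolution in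
characteristic `p` is EQUIVALENT to two-model patching of proper models ∧ the core model-form
`μ_p`-torsor steps at the rank-one valuation rings `O ⊇ k` of finitely generated `K/k`
(`char k = p`) which are residually algebraic over `k` and are NOT discrete with residues
separable-algebraic over some finitely generated field of constants `k ⊆ k₁ ⊆ O`.
`⇒` does not use `HD`. -/
theorem resolutionInChar_iff_twoModelPatching_and_sepConstRaResidual {p : ℕ} [Fact p.Prime]
    (hT₁ : Temkin2013HeightLeOne.{0}) (hCP : CossartPiltant2019LU3.{0})
    (HD : ∀ (k K : Type) [Field k] [CharP k p] [Field K] [Algebra k K],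
      (⊤ : IntermediateField k K).FG → ∀ O : ValuationSubring K, Nonempty O.valuation.RankOne →
        (∀ c : k, algebraMap k K c ∈ O) → IsDiscreteValuationRing O →
        (∀ t : K, t ∈ O → HasSeparableResidue k O t) → RelMuPTorsorCoreStepsAt p k O) :
    ResolutionInChar.{0} p ↔ ProperModel.TwoModelPatching.{0} p ∧
      (∀ (k K : Type) [Field k] [CharP k p] [Field K] [Algebra k K],
        (⊤ : IntermediateField k K).FG → ∀ O : ValuationSubring K,
          Nonempty O.valuation.RankOne → (∀ c : k, algebraMap k K c ∈ O) →
          IsResiduallyAlgebraic k O →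
          ¬ (IsDiscreteValuationRing O ∧ ∃ k₁ : IntermediateField k K, k₁.FG ∧
              (∀ x : k₁, (x : K) ∈ O) ∧ ∀ t : K, t ∈ O → HasSeparableResidue k₁ O t) →
            RelMuPTorsorCoreStepsAt p k O) :=
  ⟨fun h => ⟨ProperModel.twoModelPatching_of_resolutionInChar h,
      fun k K _ _ _ _ _ O _ hk _ _ => relCoreSteps_of_resolutionInChar h k K O hk⟩,
    fun h => resolutionInChar_of_properTwoModelPatching_of_lu h.1
      (fun k K _ _ _ _ hfg O hk => isLocallyUniformizable_of_relLocalUniformization hfg O hk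
        (relLocalUniformization_of_sepConst_and_raResidual hT₁ hCP HD h.2 k K O))⟩

/-- **The summit itself, split at the residually algebraic `¬ SepConst` core** (all primes;
granted Temkin in height one, Cossart–Piltant in dimension `≤ 3`, and Theorem D for every prime
as `HD`). The right-hand local conjunct quantifies over the smallest class of valuation rings
reached by the residency's reductions: rank one, residually algebraic over the ground field, and
not a discrete valuation ring whose residues are separable-algebraic over a finitely generated
field of constants inside it. -/
theorem resolutionOfSingularities_iff_twoModelPatching_and_sepConstRaResidual
    (hT₁ : Temkin2013HeightLeOne.{0}) (hCP : CossartPiltant2019LU3.{0})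
    (HD : ∀ p : ℕ, p.Prime → ∀ (k K : Type) [Field k] [CharP k p] [Field K] [Algebra k K],
      (⊤ : IntermediateField k K).FG → ∀ O : ValuationSubring K, Nonempty O.valuation.RankOne →
        (∀ c : k, algebraMap k K c ∈ O) → IsDiscreteValuationRing O →
        (∀ t : K, t ∈ O → HasSeparableResidue k O t) → RelMuPTorsorCoreStepsAt p k O) :
    Literature.AlgebraicGeometry.Resolution.ResolutionOfSingularities ↔
      ∀ p : ℕ, p.Prime → ProperModel.TwoModelPatching.{0} p ∧
      (∀ (k K : Type) [Field k] [CharP k p] [Field K] [Algebra k K],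
        (⊤ : IntermediateField k K).FG → ∀ O : ValuationSubring K,
          Nonempty O.valuation.RankOne → (∀ c : k, algebraMap k K c ∈ O) →
          IsResiduallyAlgebraic k O →
          ¬ (IsDiscreteValuationRing O ∧ ∃ k₁ : IntermediateField k K, k₁.FG ∧
              (∀ x : k₁, (x : K) ∈ O) ∧ ∀ t : K, t ∈ O → HasSeparableResidue k₁ O t) →
            RelMuPTorsorCoreStepsAt p k O) := by
  refine forall_congr' fun p => forall_congr' fun hp => ?_
  haveI : Fact p.Prime := ⟨hp⟩
  exact resolutionInChar_iff_twoModelPatching_and_sepConstRaResidual hT₁ hCP (HD p hp)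

end Summit.ResolutionOfSingularities.ResolutionOfSingularities.Theorems

end
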